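/-
Copyright (c) 2026 the pub-hodgecm-mathlib formalisation cell (harness21).  Prover seat hodgecm-mathlib-LH4-p07 (g11) (Track A «FOUR-FRAME» free hand routed by the
CHAIR VALVE to L1; LEAD F0P6-plan (g14) BATCH #157 (3) «(K1a-3) GLOBAL ASSEMBLER for an ARBITRARY finite place set» → LH4-p07), Track B «K2-LIT»,
#184♮ = hLiu418 = stmt-HodgeConjecture-24832; desks K2E5-p16 (g8) (K1-a♮ line) and K2E3-p14 (g9) (U1-glob LEVEL 2, slot table `SLOTS-U1glob-LEVEL2` adad711f §B `Gc hGc hGR`).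
THE HEAD OF ★ G1's EULER PRODUCT OVER AN ARBITRARY FINITE PLACE SET, CONTINUED FROM BY-VALUE PLACE LETTERS — hypothesis-first on the per-place (K1a-3) regularity letters
(★ p862868 non-split ∕ ★ p862834 split ∕ ★ p862699 arch, read in ★ G1's currency by their producers) and on ★ p862937's pure-tensor factorisation; composed with ★ (K1a-4)
FILE 1∕FILE 2 and 📨 (K1a-4)″ so that #41's `T` and U1's `T ∖ v₀` are both instances.
-/
import Summits.HodgeConjecture.HodgeConjecture.Theorems.K2LiuRankOneSingularEulerContinued        -- ★ p862746 ((K1a-4) FILE 2, R90-C14-p02): `exists_Eac_of_tail_letters`, `…_scalarK1_cm` (+ ★ FILE 1)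
import Summits.HodgeConjecture.HodgeConjecture.Theorems.K2LiuBigCellContinuationPointLetters     -- ★ (K2Liu-p13 lineage): `differentiableOn_re_pos_of_forall_isQRationalRegularAt`
import HarnessLib

/-!
# Crux `HLiu418`, socket #41 KIND 1 a♮ ∕ U1-glob LEVEL 2 — `K2LiuKindOneSingularGlobalAssembler`: THE EULER HEAD OVER ANY FINITE PLACE SET `T′`, CONTINUED TO `{0 < re}`
# FROM BY-VALUE PLACE LETTERS, AND THE TAIL LETTERS `(Gc, hGc, hGR)` ∕ `(Eac, hEad, hEac)` IT FEEDS

Cell `hodgecm-mathlib`, crux item hLiu418 = `stmt-HodgeConjecture-24832`, route `HCCMUnconditional`; squad K2 ∕ K2Liu, LEAD F0P6-plan (g14); desks K2E5-p16 (g8), K2E3-p14 (g9).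
THEOREMS ONLY (no `def`, no instance, no notation, no named-fact hypothesis, no `sorry`, default heartbeats); lane `--supports stmt-HodgeConjecture-24832 --as helper`.

THE SHAPE (line lead census `CENSUS-K1a-GK` §3 (K1a-3)∕(K1a-4); K2E3-p14 slot table §B; this seat's ★ p863037 ∕ 📨 p863157).  ★ G1 `whittakerDelta_eq_mul_tprod_euler` writes the
corner-twisted singular Whittaker term as `HEAD_{T′}(s, h) · ∏'_{v∉T′} W°_v(s)` for ANY finite `T′` containing the bad data; for a PURE-TENSOR slice ★ p862937
`head_eq_archFactor_mul_prod_of_pureTensor` factors `HEAD_{T′}(s,h) = A_∞(s,h) · ∏_{v∈T′} W_v(s,h)` (and a `K`-finite standard section is a finite SUM of pure tensors).  Per place the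
(K1a-3) letters give `W_v(s,h) = Gn_v(s,h)` on `{1 < re s}` with `s ↦ Gn_v(s,h)` `q_v`-rational and regular at EVERY `s₀` of `{0 < re}` (★ p862868 `twistedRankOneRegularity_of_forall_eq`
non-split, ★ p862834 `twistedRegularity_of_pair` split — the twisted last stage has NO pole), and the arch letter gives `A_∞(s,h) = Ac(s,h)` there with `Ac(·,h)` holomorphic on `{0 < re}`
(★ p862699 lineage).  THIS FILE assembles, for an ARBITRARY finite index set `T′` (so #41's `T` and U1-glob's `T ∖ v₀` are both instances) and HYPOTHESIS-FIRST on those letters: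
* §1 **`exists_headContinuation_of_placeLetters`** — ONE pure tensor: `∃ HTc`, `s ↦ HTc s h` holomorphic on `{0 < re}` for every `h`, `HEAD = HTc` on `{c₀ < re}`, and the WITNESS
  `HTc s h = Ac s h · ∏_{v∈T′} Gn_v s h` (LH4-p11 (g10)'s (F-V) transparency: values at `s = ½` readable);
* §2 **`exists_headContinuation_of_placeLetters_sum`** — a finite SUM of pure tensors (`i ∈ I`): the same with `Σ_{i∈I} Ac_i · ∏_{v∈T′} Gn_{i,v}`;
* §3 **`exists_Gc_of_placeLetters_scalarK1_cm`** — composed with ★ (K1a-4) FILE 1∕FILE 2: if the term reads `Rst(s,h) = c · HEAD_{T′}(s,h) · sc¹^{T″}(s) · ∏_{v∈D} P_v(s)` on `{1 < re}`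
  (★ G1 ∘ ★ p862812 tail collapse; `T″` any finite set — `T′` itself for #41, `T` for U1's `Rst` read over `T ∖ v₀`) then `∃ Gc` holomorphic on `{0 < re}` in `s` for every `h` with
  `(s − ½)·Rst(s,h) = Gc(s,h)` on `{1 < re}` AND the witness `Gc = c · [Σ_i Ac_i ∏_v Gn_{i,v}] · G^{T″} · ∏_{v∈D} P_v` with `(s − ½)·sc¹^{T″} = G^{T″}` on `½ < re` — EXACTLY U1-glob
  LEVEL 2's slots `Gc hGc hGR` (K2E3-p14 §B) and, at `T′ := T`, the K1-a♮ letters `(Eac, hEad, hEac)` in ★ p862746's currency (equivalently the faces producer ★ p863037 consumes).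
NOT HERE: the per-place PRODUCERS of `(Gn_v, hGn, hW)` in ★ G1's `unipDeltaLoc ∕ locToAdelic` currency — the K1 twin of ★ (E10) `K2LiuBigCellLocalFace.exists_localFace` (frame
transport + the corner-character seam (2d) `K2LiuRankOneCornerCharacterReading`, line lead K2E5-p16) — nor the arch producer; both enter here BY VALUE.
HONEST LABEL.  Assembly algebra + holomorphy bookkeeping, count-neutral; nothing here closes a socket: `HC_CM` is proved only modulo the 7 printed citations (2 remaining named
inputs: hLiu418 = `stmt-HodgeConjecture-24832`, h413 = `stmt-HodgeConjecture-24833`) until rung 0 closes.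

## References
* [Tan1999] V. Tan, *Poles of Siegel Eisenstein series on U(n,n)*, Canad. J. Math. 51 (1999) 164–175: §3, §4 Prop. 4.8.
* [KudlaRallis1994] S. Kudla, S. Rallis, *A regularized Siegel–Weil formula: the first term identity*, Ann. of Math. 140 (1994): §2 (2.10)–(2.12).
* [KudlaSweet1997] S. Kudla, W. J. Sweet, *Degenerate principal series representations for U(n,n)*, Israel J. Math. 98 (1997): §1.
* [HarrisKudlaSweet1996] M. Harris, S. Kudla, W. J. Sweet, *Theta dichotomy for unitary groups*, J. AMS 9 (1996): §6 (6.14)–(6.16) (place-by-place factors).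
-/

set_option autoImplicit false
set_option linter.dupNamespace false -- the mandated namespace repeats `HodgeConjecture.HodgeConjecture`

noncomputable section

open scoped NNReal
open Filter Topology Complex NumberField IsDedekindDomain
open Literature.NumberTheory.Automorphic Literature.NumberTheory.LFunctions Literature.NumberTheory.GaloisRepresentations
open Summit.HodgeConjecture.HodgeConjecture.Cruxes.HLiu418.K2LiuQRationalDefs (IsQRationalRegularAt)
open Summit.HodgeConjecture.HodgeConjecture.Cruxes.HLiu418.K2LiuBigCellContinuationPointLetters (differentiableOn_re_pos_of_forall_isQRationalRegularAt)
open Summit.HodgeConjecture.HodgeConjecture.Cruxes.HLiu418.K2LiuKindOneSingularScalarGL1 (exists_differentiableOn_sub_half_mul_scalarK1_cm)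
open Summit.HodgeConjecture.HodgeConjecture.Cruxes.HLiu418.K2LiuRankOneSingularEulerContinued (exists_Eac_of_tail_letters)

namespace Summit.HodgeConjecture.HodgeConjecture.Cruxes.HLiu418.K2LiuKindOneSingularGlobalAssembler

/-! ## §1 One pure tensor: the head over a finite place set from its place letters -/

/-- **THE EULER HEAD OVER ANY FINITE PLACE SET, CONTINUED FROM ITS PLACE LETTERS (one pure tensor).**  Index set `T′` (any finite set of «places», residue cardinalities
`q v ≠ 0`), a head `HT : ℂ → H → ℂ` which on `{c₀ < re}` is the pure tensor `A s h · ∏_{v∈T′} W v s h` (★ p862937's shape); the arch letter `A = Ac` on `{c₀ < re}` with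
`s ↦ Ac s h` holomorphic on `{0 < re}`; the finite-place letters `W v = Gn v` on `{c₀ < re}` with `s ↦ Gn v s h` `q_v`-rational regular at EVERY `s₀` of `{0 < re}` ((K1a-3)'s
«no pole» shape).  THEN `HTc s h := Ac s h · ∏_{v∈T′} Gn v s h` is holomorphic on `{0 < re}` in `s` for every `h`, equals `HT` on `{c₀ < re}`, and the witness equation holds.
[cite: Tan1999, §3; §4 Prop. 4.8] [cite: KudlaSweet1997, §1] [cite: HarrisKudlaSweet1996, §6 (6.14)–(6.16)] -/
theorem exists_headContinuation_of_placeLetters {H ι : Type*} (T : Finset ι) (q : ι → ℕ) (hq : ∀ v ∈ T, q v ≠ 0) (c₀ : ℝ)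
    (HT A : ℂ → H → ℂ) (W : ι → ℂ → H → ℂ)
    (hsplit : ∀ s : ℂ, c₀ < s.re → ∀ h, HT s h = A s h * ∏ v ∈ T, W v s h)
    (Ac : ℂ → H → ℂ) (hAc : ∀ h, DifferentiableOn ℂ (fun s => Ac s h) {s : ℂ | 0 < s.re}) (hA : ∀ s : ℂ, c₀ < s.re → ∀ h, A s h = Ac s h)
    (Gn : ι → ℂ → H → ℂ) (hGn : ∀ v ∈ T, ∀ s₀ : ℂ, 0 < s₀.re → ∀ h, IsQRationalRegularAt (q v) s₀ (fun s => Gn v s h))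
    (hW : ∀ v ∈ T, ∀ s : ℂ, c₀ < s.re → ∀ h, W v s h = Gn v s h) :
    ∃ HTc : ℂ → H → ℂ,
      (∀ h, DifferentiableOn ℂ (fun s => HTc s h) {s : ℂ | 0 < s.re}) ∧
      (∀ s : ℂ, c₀ < s.re → ∀ h, HT s h = HTc s h) ∧
      (∀ s h, HTc s h = Ac s h * ∏ v ∈ T, Gn v s h) := by
  refine ⟨fun s h => Ac s h * ∏ v ∈ T, Gn v s h, fun h => ?_, fun s hs h => ?_, fun s h => rfl⟩
  · exact (hAc h).mul (DifferentiableOn.fun_finsetProd fun v hv =>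
      differentiableOn_re_pos_of_forall_isQRationalRegularAt (hq v hv) fun s₀ hs₀ => hGn v hv s₀ hs₀ h)
  · rw [hsplit s hs h, hA s hs h]
    exact congrArg _ (Finset.prod_congr rfl fun v hv => hW v hv s hs h)

/-! ## §2 A finite sum of pure tensors (a `K`-finite standard section) -/

/-- **THE EULER HEAD FROM ITS PLACE LETTERS, SUMMED OVER FINITELY MANY PURE TENSORS.**  As §1 with `HT = Σ_{i∈I} A i · ∏_{v∈T′} W i v` on `{c₀ < re}` and the letters per
tensor `i ∈ I`; witness `HTc = Σ_{i∈I} Ac i · ∏_{v∈T′} Gn i v`. [cite: Tan1999, §3] [cite: KudlaSweet1997, §1] [cite: HarrisKudlaSweet1996, §6 (6.14)–(6.16)] -/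
theorem exists_headContinuation_of_placeLetters_sum {H ι ι' : Type*} (I : Finset ι') (T : Finset ι) (q : ι → ℕ) (hq : ∀ v ∈ T, q v ≠ 0) (c₀ : ℝ)
    (HT : ℂ → H → ℂ) (A : ι' → ℂ → H → ℂ) (W : ι' → ι → ℂ → H → ℂ)
    (hsplit : ∀ s : ℂ, c₀ < s.re → ∀ h, HT s h = ∑ i ∈ I, A i s h * ∏ v ∈ T, W i v s h)
    (Ac : ι' → ℂ → H → ℂ) (hAc : ∀ i ∈ I, ∀ h, DifferentiableOn ℂ (fun s => Ac i s h) {s : ℂ | 0 < s.re})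
    (hA : ∀ i ∈ I, ∀ s : ℂ, c₀ < s.re → ∀ h, A i s h = Ac i s h)
    (Gn : ι' → ι → ℂ → H → ℂ) (hGn : ∀ i ∈ I, ∀ v ∈ T, ∀ s₀ : ℂ, 0 < s₀.re → ∀ h, IsQRationalRegularAt (q v) s₀ (fun s => Gn i v s h))
    (hW : ∀ i ∈ I, ∀ v ∈ T, ∀ s : ℂ, c₀ < s.re → ∀ h, W i v s h = Gn i v s h) :
    ∃ HTc : ℂ → H → ℂ,
      (∀ h, DifferentiableOn ℂ (fun s => HTc s h) {s : ℂ | 0 < s.re}) ∧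
      (∀ s : ℂ, c₀ < s.re → ∀ h, HT s h = HTc s h) ∧
      (∀ s h, HTc s h = ∑ i ∈ I, Ac i s h * ∏ v ∈ T, Gn i v s h) := by
  refine ⟨fun s h => ∑ i ∈ I, Ac i s h * ∏ v ∈ T, Gn i v s h, fun h => ?_, fun s hs h => ?_, fun s h => rfl⟩
  · exact DifferentiableOn.fun_sum fun i hi => (hAc i hi h).mul (DifferentiableOn.fun_finsetProd fun v hv =>
      differentiableOn_re_pos_of_forall_isQRationalRegularAt (hq v hv) fun s₀ hs₀ => hGn i hi v hv s₀ hs₀ h)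
  · rw [hsplit s hs h]
    exact Finset.sum_congr rfl fun i hi => by
      rw [hA i hi s hs h]
      exact congrArg _ (Finset.prod_congr rfl fun v hv => hW i hi v hv s hs h)

/-! ## §3 Composition with the K1 scalar of record: the tail letters `(Gc, hGc, hGR)` ∕ `(Eac, hEad, hEac)` with their witness -/

section CM

variable (L : Type) [Field L] [NumberField L] [IsCMField L]

/-- **THE TAIL LETTERS FROM PLACE LETTERS AT THE K2_Liu FRAME.**  Suppose the (normalised, possibly restricted) singular term reads on `{1 < re}`
`Rst s h = c · HEAD s h · [ζ_{L⁺}^{T″}(2s) ∕ (ζ_{L⁺}^{T″}(2s+1)·L^{T″}(2s+2, ε_{L∕L⁺}))] · ∏_{v∈D} P v s` (★ G1 ∘ ★ p862812 tail collapse; `T″` any finite set of places of `L⁺`, `D` finite,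
`P v` holomorphic on `{0 < re}`), with the head a finite sum of pure tensors over the finite index set `T′` carrying the §2 place letters (`c₀ := 1`).  THEN there is `Gc : ℂ → H → ℂ`,
holomorphic on `{0 < re}` in `s` for every `h`, with `(s − ½)·Rst s h = Gc s h` on `{1 < re}` — U1-glob LEVEL 2's `Gc hGc hGR` (K2E3-p14 §B, `T″ := T`, `T′ := T ∖ v₀`) and #41's
K1-a♮ `(Eac, hEad, hEac)` in ★ p862746's currency (`T″ = T′ := T`) — TOGETHER WITH THE WITNESS: the pole-cleared K1 scalar `G` used (★ FILE 1, `(s − ½)·sc¹^{T″} = G` on `½ < re`)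
and `Gc s h = c · [Σ_{i∈I} Ac i s h ∏_{v∈T′} Gn i v s h] · G s · ∏_{v∈D} P v s`. [cite: Tan1999, §3; §4 Prop. 4.8] [cite: KudlaRallis1994, §2 (2.10)–(2.12)] [cite: KudlaSweet1997, §1] -/
theorem exists_Gc_of_placeLetters_scalarK1_cm {H ι ι' κ : Type*} {T'' : Set (HeightOneSpectrum (𝓞 ↥(maximalRealSubfield L)))} (hT'' : T''.Finite)
    (Rst HT : ℂ → H → ℂ) (c : ℂ) (D : Finset κ) (P : κ → ℂ → ℂ) (hP : ∀ v ∈ D, DifferentiableOn ℂ (P v) {s : ℂ | 0 < s.re})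
    (htail : ∀ s : ℂ, 1 < s.re → ∀ h, Rst s h =
      c * HT s h *
        (partialStandardL T'' (fun _ => {1}) (2 * s) /
          (partialStandardL T'' (fun _ => {1}) (2 * s + 1) *
            partialStandardL T'' (fun v => {(quadraticHeckeCharCM L).valueAtUniformizer v}) (2 * s + 2))) *
        ∏ v ∈ D, P v s)
    (I : Finset ι') (T : Finset ι) (q : ι → ℕ) (hq : ∀ v ∈ T, q v ≠ 0)
    (A : ι' → ℂ → H → ℂ) (W : ι' → ι → ℂ → H → ℂ)
    (hsplit : ∀ s : ℂ, 1 < s.re → ∀ h, HT s h = ∑ i ∈ I, A i s h * ∏ v ∈ T, W i v s h)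
    (Ac : ι' → ℂ → H → ℂ) (hAc : ∀ i ∈ I, ∀ h, DifferentiableOn ℂ (fun s => Ac i s h) {s : ℂ | 0 < s.re})
    (hA : ∀ i ∈ I, ∀ s : ℂ, 1 < s.re → ∀ h, A i s h = Ac i s h)
    (Gn : ι' → ι → ℂ → H → ℂ) (hGn : ∀ i ∈ I, ∀ v ∈ T, ∀ s₀ : ℂ, 0 < s₀.re → ∀ h, IsQRationalRegularAt (q v) s₀ (fun s => Gn i v s h))
    (hW : ∀ i ∈ I, ∀ v ∈ T, ∀ s : ℂ, 1 < s.re → ∀ h, W i v s h = Gn i v s h) :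
    ∃ Gc : ℂ → H → ℂ,
      (∀ h, DifferentiableOn ℂ (fun s => Gc s h) {s : ℂ | 0 < s.re}) ∧
      (∀ s : ℂ, 1 < s.re → ∀ h, (s - 1 / 2) * Rst s h = Gc s h) ∧
      ∃ G : ℂ → ℂ, DifferentiableOn ℂ G {s : ℂ | 0 < s.re} ∧
        (∀ s : ℂ, 1 / 2 < s.re →
          (s - 1 / 2) *
            (partialStandardL T'' (fun _ => {1}) (2 * s) /
              (partialStandardL T'' (fun _ => {1}) (2 * s + 1) *
                partialStandardL T'' (fun v => {(quadraticHeckeCharCM L).valueAtUniformizer v}) (2 * s + 2))) = G s) ∧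
        ∀ s h, Gc s h = c * (∑ i ∈ I, Ac i s h * ∏ v ∈ T, Gn i v s h) * G s * ∏ v ∈ D, P v s := by
  -- the head, continued (§2 at `c₀ := 1`)
  obtain ⟨HTc, hHTc, hHTeq, hHTw⟩ := exists_headContinuation_of_placeLetters_sum I T q hq 1 HT A W hsplit Ac hAc hA Gn hGn hW
  -- the pole-cleared K1 scalar (★ FILE 1)
  obtain ⟨G, hG, hsc⟩ := exists_differentiableOn_sub_half_mul_scalarK1_cm L hT''
  refine ⟨fun s h => c * HTc s h * G s * ∏ v ∈ D, P v s, fun h => ?_, fun s hs h => ?_, G, hG, hsc, fun s h => ?_⟩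
  · exact (((differentiableOn_const c).mul (hHTc h)).mul hG).mul (DifferentiableOn.fun_finsetProd hP)
  · have hs' : 1 / 2 < s.re := by linarith
    show (s - 1 / 2) * Rst s h = c * HTc s h * G s * ∏ v ∈ D, P v s
    rw [htail s hs h, hHTeq s hs h, ← hsc s hs']
    ring
  · show c * HTc s h * G s * ∏ v ∈ D, P v s = _
    rw [hHTw]

/-- **THE ONE-TENSOR FORM** of `exists_Gc_of_placeLetters_scalarK1_cm` (a section PURE at the places of `T′`, e.g. U1-glob's `stdExtension` slice or one term of ★
`exists_sum_pure_at_of_isStandardSectionFamily`): `HEAD = A · ∏_{v∈T′} W v` on `{1 < re}`. [cite: Tan1999, §4 Prop. 4.8] [cite: KudlaSweet1997, §1] -/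
theorem exists_Gc_of_placeLetters_scalarK1_cm_pure {H ι κ : Type*} {T'' : Set (HeightOneSpectrum (𝓞 ↥(maximalRealSubfield L)))} (hT'' : T''.Finite)
    (Rst HT : ℂ → H → ℂ) (c : ℂ) (D : Finset κ) (P : κ → ℂ → ℂ) (hP : ∀ v ∈ D, DifferentiableOn ℂ (P v) {s : ℂ | 0 < s.re})
    (htail : ∀ s : ℂ, 1 < s.re → ∀ h, Rst s h =
      c * HT s h *
        (partialStandardL T'' (fun _ => {1}) (2 * s) /
          (partialStandardL T'' (fun _ => {1}) (2 * s + 1) *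
            partialStandardL T'' (fun v => {(quadraticHeckeCharCM L).valueAtUniformizer v}) (2 * s + 2))) *
        ∏ v ∈ D, P v s)
    (T : Finset ι) (q : ι → ℕ) (hq : ∀ v ∈ T, q v ≠ 0)
    (A : ℂ → H → ℂ) (W : ι → ℂ → H → ℂ)
    (hsplit : ∀ s : ℂ, 1 < s.re → ∀ h, HT s h = A s h * ∏ v ∈ T, W v s h)
    (Ac : ℂ → H → ℂ) (hAc : ∀ h, DifferentiableOn ℂ (fun s => Ac s h) {s : ℂ | 0 < s.re}) (hA : ∀ s : ℂ, 1 < s.re → ∀ h, A s h = Ac s h)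
    (Gn : ι → ℂ → H → ℂ) (hGn : ∀ v ∈ T, ∀ s₀ : ℂ, 0 < s₀.re → ∀ h, IsQRationalRegularAt (q v) s₀ (fun s => Gn v s h))
    (hW : ∀ v ∈ T, ∀ s : ℂ, 1 < s.re → ∀ h, W v s h = Gn v s h) :
    ∃ Gc : ℂ → H → ℂ,
      (∀ h, DifferentiableOn ℂ (fun s => Gc s h) {s : ℂ | 0 < s.re}) ∧
      (∀ s : ℂ, 1 < s.re → ∀ h, (s - 1 / 2) * Rst s h = Gc s h) ∧
      ∃ G : ℂ → ℂ, DifferentiableOn ℂ G {s : ℂ | 0 < s.re} ∧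
        (∀ s : ℂ, 1 / 2 < s.re →
          (s - 1 / 2) *
            (partialStandardL T'' (fun _ => {1}) (2 * s) /
              (partialStandardL T'' (fun _ => {1}) (2 * s + 1) *
                partialStandardL T'' (fun v => {(quadraticHeckeCharCM L).valueAtUniformizer v}) (2 * s + 2))) = G s) ∧
        ∀ s h, Gc s h = c * (Ac s h * ∏ v ∈ T, Gn v s h) * G s * ∏ v ∈ D, P v s := by
  obtain ⟨Gc, hGc, hGR, G, hG, hsc, hw⟩ := exists_Gc_of_placeLetters_scalarK1_cm L hT'' Rst HT c D P hP htail ({()} : Finset Unit) T q hq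
    (fun _ => A) (fun _ => W) (fun s hs h => by rw [Finset.sum_singleton]; exact hsplit s hs h) (fun _ => Ac) (fun _ _ => hAc) (fun _ _ => hA)
    (fun _ => Gn) (fun _ _ => hGn) (fun _ _ => hW)
  exact ⟨Gc, hGc, hGR, G, hG, hsc, fun s h => by rw [hw, Finset.sum_singleton]⟩

end CM

end Summit.HodgeConjecture.HodgeConjecture.Cruxes.HLiu418.K2LiuKindOneSingularGlobalAssembler

end
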